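import Literature.MathematicalPhysics.QuantumFieldTheory.LatticeYangMillsBakryEmery
import Summits.Ventures.YMGap.Thresholds.SharpWindow

/-!
# Venture YMGap — Theorem C, consequence V: large-`N` concentration of the plaquette for
# `|β| < 1/(8d)` (Shen–Zhu–Zhu Cor. 1.5, plaquette case), conditionally on the Bakry–Émery step

HONEST FRAMING: venture file (cell `pub-ymgap`, track (a), item A2, large-`N` leg = Theorem A (A4)
of `paper/gap-below-beta0prime.md` for the plaquette loop). KERNEL-CHECKED here: the normalised
plaquette `W_p/N = (1/N) Re tr(U₁U₂U₃^*U₄^*)` is a smooth cylinder function whose per-link Lipschitz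
constants (Frobenius distance) are `≤ 4/√N` (`plaqFun_lipschitz`; telescoping, unitary invariance of
the Hilbert–Schmidt norm). CONDITIONAL (on the NAMED printed fact `shenZhuZhu_bakryEmery_transfer`
= SZZ Theorem 4.2 / Cor. 4.5 with the Hessian constant as a parameter, through
`SharpWindow.sharp_functionalInequalities`): `plaquette_variance_sharp` — for `d ≥ 2`, `N ≥ 1`,
`|β| < 1/(8d)` and every infinite-volume limit point `μ` of the torus `SU(N)` Wilson states at tree
coupling `Nβ`: `Var_μ(W_p/N) ≤ (1/K)·(64/N)` with `K = N/2 - 4dN|β|`, i.e. `≤ 128/(N²(1 - 8d|β|))`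
(`plaquette_variance_sharp'`) — the plaquette concentrates as `N → ∞` at fixed 't Hooft coupling
below `1/(8d)` (SZZ Cor. 1.5 prints `Var(W_ℓ/N) ≤ 4n(n-3)/(K_S N)` for `|β| < 1/(16(d-1))`; the
constant `64` here is not optimised). Nothing at physical couplings; no factorisation of products of
loops is derived here.

Reference: H. Shen, R. Zhu, X. Zhu, CMP 400 (2023), Cor. 1.5, §4.2; cell file
`paper/gap-below-beta0prime.md` Thm A (A4).
-/

noncomputable section

namespace Summit.Ventures.YMGap.HessianSharp

open MeasureTheory ProbabilityTheory Matrix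
open Literature.MathematicalPhysics.QuantumFieldTheory
open Literature.MathematicalPhysics.QuantumLattice
open scoped Matrix Matrix.Norms.Frobenius ContDiff

variable {d N : ℕ}

local notation "ZdP" => Literature.MathematicalPhysics.QuantumLattice.ZdPlaquette

/-! ## The plaquette as a cylinder function of its four links -/

/-- The first link `(x, i)` of the plaquette `p = (x; i<j)`, as an element of `plaquetteEdges p`. -/
def pe₁ (p : ZdP d) : ↥(plaquetteEdges p) := ⟨(p.1, p.2.1.1), by simp [plaquetteEdges]⟩
/-- The second link `(x + eᵢ, j)`. -/
def pe₂ (p : ZdP d) : ↥(plaquetteEdges p) :=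
  ⟨(p.1 + Pi.single p.2.1.1 1, p.2.1.2), by simp [plaquetteEdges]⟩
/-- The third link `(x + eⱼ, i)` (traversed backwards). -/
def pe₃ (p : ZdP d) : ↥(plaquetteEdges p) :=
  ⟨(p.1 + Pi.single p.2.1.2 1, p.2.1.1), by simp [plaquetteEdges]⟩
/-- The fourth link `(x, j)` (traversed backwards). -/
def pe₄ (p : ZdP d) : ↥(plaquetteEdges p) := ⟨(p.1, p.2.1.2), by simp [plaquetteEdges]⟩

/-- The normalised plaquette function of the four link matrices,
`f(M) = (1/N) Re tr(M₁ M₂ M₃^* M₄^*)` (for `SU(N)` links `M^* = M⁻¹`, so this is `(1/N) Re tr hol_p`). -/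
def plaqFun (p : ZdP d) (M : ↥(plaquetteEdges p) → Matrix (Fin N) (Fin N) ℂ) : ℝ :=
  (N : ℝ)⁻¹ * (M (pe₁ p) * M (pe₂ p) * (M (pe₃ p))ᴴ * (M (pe₄ p))ᴴ).trace.re

/-- Conjugate transposition as a continuous `ℝ`-linear map (finite dimension). -/
def conjTransposeCLM : Matrix (Fin N) (Fin N) ℂ →L[ℝ] Matrix (Fin N) (Fin N) ℂ :=
  LinearMap.toContinuousLinearMap
    { toFun := fun M => Mᴴ
      map_add' := fun A B => conjTranspose_add A B
      map_smul' := fun c A => by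
        rw [conjTranspose_smul, star_trivial, RingHom.id_apply] }

/-- Evaluation of `conjTransposeCLM`. -/
@[simp] theorem conjTransposeCLM_apply (M : Matrix (Fin N) (Fin N) ℂ) : conjTransposeCLM M = Mᴴ := rfl

/-- The real part of the trace as a continuous `ℝ`-linear functional. -/
def reTraceCLM : Matrix (Fin N) (Fin N) ℂ →L[ℝ] ℝ :=
  LinearMap.toContinuousLinearMap
    { toFun := fun M => M.trace.re
      map_add' := fun A B => by simp [trace_add]
      map_smul' := fun r A => by simp [trace_smul] }

/-- Evaluation of `reTraceCLM`. -/
@[simp] theorem reTraceCLM_apply (M : Matrix (Fin N) (Fin N) ℂ) : reTraceCLM M = M.trace.re := rfl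

/-- The plaquette function is smooth (a polynomial in the entries). -/
theorem contDiff_plaqFun (p : ZdP d) : ContDiff ℝ ∞ (plaqFun (N := N) p) := by
  have hproj : ∀ k : ↥(plaquetteEdges p),
      ContDiff ℝ ∞ (fun M : ↥(plaquetteEdges p) → Matrix (Fin N) (Fin N) ℂ => M k) :=
    fun k => contDiff_apply ℝ (Matrix (Fin N) (Fin N) ℂ) k
  have h3 : ContDiff ℝ ∞ (fun M : ↥(plaquetteEdges p) → Matrix (Fin N) (Fin N) ℂ => (M (pe₃ p))ᴴ) :=
    (conjTransposeCLM (N := N)).contDiff.comp (hproj (pe₃ p))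
  have h4 : ContDiff ℝ ∞ (fun M : ↥(plaquetteEdges p) → Matrix (Fin N) (Fin N) ℂ => (M (pe₄ p))ᴴ) :=
    (conjTransposeCLM (N := N)).contDiff.comp (hproj (pe₄ p))
  have hw : ContDiff ℝ ∞ (fun M : ↥(plaquetteEdges p) → Matrix (Fin N) (Fin N) ℂ =>
      M (pe₁ p) * M (pe₂ p) * (M (pe₃ p))ᴴ * (M (pe₄ p))ᴴ) :=
    (((hproj (pe₁ p)).mul (hproj (pe₂ p))).mul h3).mul h4
  exact contDiff_const.mul ((reTraceCLM (N := N)).contDiff.comp hw)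

/-! ## Per-link Lipschitz bound: `4/√N` in the Frobenius distance -/

/-- `|Re tr(P X Q)| ≤ √N ‖X‖_F` for unitary `P` and `Q` a product form with `‖Q‖_F = √N`… stated in
the form used below: `|Re tr(A B)| ≤ ‖A‖_F ‖B‖_F` with unitary factors stripped. -/
theorem abs_re_trace_triple_le {P X Q : Matrix (Fin N) (Fin N) ℂ} (hP : P ∈ Matrix.unitaryGroup (Fin N) ℂ)
    (hQ : frobNorm Q ≤ Real.sqrt N) : |(P * X * Q).trace.re| ≤ Real.sqrt N * frobNorm X := by
  calc |(P * X * Q).trace.re| ≤ frobNorm (P * X) * frobNorm Q := abs_re_trace_mul_le _ _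
    _ = frobNorm X * frobNorm Q := by rw [frobNorm_unitary_mul hP]
    _ ≤ frobNorm X * Real.sqrt N := mul_le_mul_of_nonneg_left hQ (frobNorm_nonneg _)
    _ = Real.sqrt N * frobNorm X := mul_comm _ _

/-- Frobenius norm of a product `U V` of a unitary `U` and a matrix of norm `√N`… general form:
`‖U A‖_F = ‖A‖_F`. Products of (conjugate transposes of) `SU(N)` matrices have norm `√N`. -/
theorem frobNorm_su_prod_two (a b : Matrix.specialUnitaryGroup (Fin N) ℂ) :
    frobNorm ((a : Matrix (Fin N) (Fin N) ℂ)ᴴ * (b : Matrix (Fin N) (Fin N) ℂ)ᴴ) = Real.sqrt N := by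
  rw [frobNorm_unitary_mul (conjTranspose_mem_unitaryGroup (su_mem_unitaryGroup a)),
    frobNorm_conjTranspose, frobNorm_su]

/-- **Telescoping bound.** For `SU(N)` links, the normalised plaquette changes by at most
`(1/√N) Σ_k ‖M_k - M'_k‖_F` over its four links. -/
theorem plaqFun_sub_le (p : ZdP d) (M M' : ↥(plaquetteEdges p) → Matrix.specialUnitaryGroup (Fin N) ℂ)
    (hN : 1 ≤ N) :
    |plaqFun p (fun e => (M e : Matrix (Fin N) (Fin N) ℂ)) -
        plaqFun p (fun e => (M' e : Matrix (Fin N) (Fin N) ℂ))| ≤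
      (Real.sqrt N)⁻¹ * (suFrobDist (M (pe₁ p)) (M' (pe₁ p)) + suFrobDist (M (pe₂ p)) (M' (pe₂ p))
        + suFrobDist (M (pe₃ p)) (M' (pe₃ p)) + suFrobDist (M (pe₄ p)) (M' (pe₄ p))) := by
  -- names
  set A₁ : Matrix (Fin N) (Fin N) ℂ := (M (pe₁ p) : Matrix (Fin N) (Fin N) ℂ) with hA₁
  set A₂ : Matrix (Fin N) (Fin N) ℂ := (M (pe₂ p) : Matrix (Fin N) (Fin N) ℂ) with hA₂
  set A₃ : Matrix (Fin N) (Fin N) ℂ := (M (pe₃ p) : Matrix (Fin N) (Fin N) ℂ) with hA₃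
  set A₄ : Matrix (Fin N) (Fin N) ℂ := (M (pe₄ p) : Matrix (Fin N) (Fin N) ℂ) with hA₄
  set B₁ : Matrix (Fin N) (Fin N) ℂ := (M' (pe₁ p) : Matrix (Fin N) (Fin N) ℂ) with hB₁
  set B₂ : Matrix (Fin N) (Fin N) ℂ := (M' (pe₂ p) : Matrix (Fin N) (Fin N) ℂ) with hB₂
  set B₃ : Matrix (Fin N) (Fin N) ℂ := (M' (pe₃ p) : Matrix (Fin N) (Fin N) ℂ) with hB₃
  set B₄ : Matrix (Fin N) (Fin N) ℂ := (M' (pe₄ p) : Matrix (Fin N) (Fin N) ℂ) with hB₄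
  have uA₁ : A₁ ∈ Matrix.unitaryGroup (Fin N) ℂ := su_mem_unitaryGroup _
  have uA₂ : A₂ ∈ Matrix.unitaryGroup (Fin N) ℂ := su_mem_unitaryGroup _
  have uB₁ : B₁ ∈ Matrix.unitaryGroup (Fin N) ℂ := su_mem_unitaryGroup _
  have uB₂ : B₂ ∈ Matrix.unitaryGroup (Fin N) ℂ := su_mem_unitaryGroup _
  have uB₃ : B₃ᴴ ∈ Matrix.unitaryGroup (Fin N) ℂ := conjTranspose_mem_unitaryGroup (su_mem_unitaryGroup _)
  have h1 : (1 : Matrix (Fin N) (Fin N) ℂ) ∈ Matrix.unitaryGroup (Fin N) ℂ := Submonoid.one_mem _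
  have hN0 : (0 : ℝ) < N := by exact_mod_cast hN
  have hsq : (0 : ℝ) < Real.sqrt N := Real.sqrt_pos.2 hN0
  -- telescoping identity
  have htel : A₁ * A₂ * A₃ᴴ * A₄ᴴ - B₁ * B₂ * B₃ᴴ * B₄ᴴ =
      1 * (A₁ - B₁) * (A₂ * A₃ᴴ * A₄ᴴ) + B₁ * (A₂ - B₂) * (A₃ᴴ * A₄ᴴ)
      + B₁ * B₂ * (A₃ - B₃)ᴴ * A₄ᴴ + B₁ * B₂ * B₃ᴴ * (A₄ - B₄)ᴴ * 1 := by
    rw [conjTranspose_sub, conjTranspose_sub]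
    noncomm_ring
  -- norms of the unitary tails
  have t1 : frobNorm (A₂ * A₃ᴴ * A₄ᴴ) ≤ Real.sqrt N := by
    rw [Matrix.mul_assoc, frobNorm_unitary_mul uA₂, frobNorm_su_prod_two]
  have t2 : frobNorm (A₃ᴴ * A₄ᴴ) ≤ Real.sqrt N := by rw [frobNorm_su_prod_two]
  have t3 : frobNorm (A₄ᴴ) ≤ Real.sqrt N := by rw [frobNorm_conjTranspose, frobNorm_su]
  have t4 : frobNorm (1 : Matrix (Fin N) (Fin N) ℂ) ≤ Real.sqrt N := by
    rw [← Real.sqrt_sq (frobNorm_nonneg _), frobNorm_sq_of_mem_unitaryGroup h1, Fintype.card_fin]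
  -- the four terms
  have e1 : |(1 * (A₁ - B₁) * (A₂ * A₃ᴴ * A₄ᴴ)).trace.re| ≤ Real.sqrt N * frobNorm (A₁ - B₁) :=
    abs_re_trace_triple_le h1 t1
  have e2 : |(B₁ * (A₂ - B₂) * (A₃ᴴ * A₄ᴴ)).trace.re| ≤ Real.sqrt N * frobNorm (A₂ - B₂) :=
    abs_re_trace_triple_le uB₁ t2
  have e3 : |(B₁ * B₂ * (A₃ - B₃)ᴴ * A₄ᴴ).trace.re| ≤ Real.sqrt N * frobNorm (A₃ - B₃) := by
    have := abs_re_trace_triple_le (X := (A₃ - B₃)ᴴ) (Submonoid.mul_mem _ uB₁ uB₂) t3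
    rwa [frobNorm_conjTranspose] at this
  have e4 : |(B₁ * B₂ * B₃ᴴ * (A₄ - B₄)ᴴ * 1).trace.re| ≤ Real.sqrt N * frobNorm (A₄ - B₄) := by
    have := abs_re_trace_triple_le (X := (A₄ - B₄)ᴴ)
      (Submonoid.mul_mem _ (Submonoid.mul_mem _ uB₁ uB₂) uB₃) t4
    rwa [frobNorm_conjTranspose] at this
  -- assemble
  have hdiff : plaqFun p (fun e => (M e : Matrix (Fin N) (Fin N) ℂ)) -
      plaqFun p (fun e => (M' e : Matrix (Fin N) (Fin N) ℂ)) =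
      (N : ℝ)⁻¹ * ((A₁ * A₂ * A₃ᴴ * A₄ᴴ - B₁ * B₂ * B₃ᴴ * B₄ᴴ).trace.re) := by
    simp only [plaqFun, ← hA₁, ← hA₂, ← hA₃, ← hA₄, ← hB₁, ← hB₂, ← hB₃, ← hB₄, trace_sub,
      Complex.sub_re]
    ring
  rw [hdiff, htel]
  simp only [trace_add, Complex.add_re]
  rw [abs_mul, abs_of_pos (inv_pos.2 hN0)]
  have hsum : |(1 * (A₁ - B₁) * (A₂ * A₃ᴴ * A₄ᴴ)).trace.re + (B₁ * (A₂ - B₂) * (A₃ᴴ * A₄ᴴ)).trace.re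
      + (B₁ * B₂ * (A₃ - B₃)ᴴ * A₄ᴴ).trace.re + (B₁ * B₂ * B₃ᴴ * (A₄ - B₄)ᴴ * 1).trace.re|
      ≤ Real.sqrt N * (frobNorm (A₁ - B₁) + frobNorm (A₂ - B₂) + frobNorm (A₃ - B₃)
        + frobNorm (A₄ - B₄)) := by
    have T1 := abs_add_le ((1 * (A₁ - B₁) * (A₂ * A₃ᴴ * A₄ᴴ)).trace.re
      + (B₁ * (A₂ - B₂) * (A₃ᴴ * A₄ᴴ)).trace.re + (B₁ * B₂ * (A₃ - B₃)ᴴ * A₄ᴴ).trace.re)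
      ((B₁ * B₂ * B₃ᴴ * (A₄ - B₄)ᴴ * 1).trace.re)
    have T2 := abs_add_le ((1 * (A₁ - B₁) * (A₂ * A₃ᴴ * A₄ᴴ)).trace.re
      + (B₁ * (A₂ - B₂) * (A₃ᴴ * A₄ᴴ)).trace.re) ((B₁ * B₂ * (A₃ - B₃)ᴴ * A₄ᴴ).trace.re)
    have T3 := abs_add_le ((1 * (A₁ - B₁) * (A₂ * A₃ᴴ * A₄ᴴ)).trace.re)
      ((B₁ * (A₂ - B₂) * (A₃ᴴ * A₄ᴴ)).trace.re)
    linarith [T1, T2, T3, e1, e2, e3, e4]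
  have hsuF : frobNorm (A₁ - B₁) + frobNorm (A₂ - B₂) + frobNorm (A₃ - B₃) + frobNorm (A₄ - B₄) =
      suFrobDist (M (pe₁ p)) (M' (pe₁ p)) + suFrobDist (M (pe₂ p)) (M' (pe₂ p))
        + suFrobDist (M (pe₃ p)) (M' (pe₃ p)) + suFrobDist (M (pe₄ p)) (M' (pe₄ p)) := by
    simp only [suFrobDist, hA₁, hA₂, hA₃, hA₄, hB₁, hB₂, hB₃, hB₄]
  rw [← hsuF]
  have hNsq : (N : ℝ)⁻¹ * Real.sqrt N = (Real.sqrt N)⁻¹ := by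
    nth_rw 1 [← Real.mul_self_sqrt hN0.le]
    rw [mul_inv, mul_assoc, inv_mul_cancel₀ hsq.ne', mul_one]
  calc (N : ℝ)⁻¹ * |_| ≤ (N : ℝ)⁻¹ * (Real.sqrt N * (frobNorm (A₁ - B₁) + frobNorm (A₂ - B₂)
        + frobNorm (A₃ - B₃) + frobNorm (A₄ - B₄))) :=
        mul_le_mul_of_nonneg_left hsum (inv_nonneg.2 hN0.le)
    _ = (Real.sqrt N)⁻¹ * (frobNorm (A₁ - B₁) + frobNorm (A₂ - B₂) + frobNorm (A₃ - B₃)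
        + frobNorm (A₄ - B₄)) := by rw [← mul_assoc, hNsq]

/-- **Per-link Lipschitz constant `4/√N`.** If two `SU(N)` link assignments agree off the link `e`,
the normalised plaquette changes by at most `(4/√N) ‖M_e - M'_e‖_F` (each of the four terms of
the telescoping sum is either zero or the `e`-term). -/
theorem plaqFun_lipschitz (p : ZdP d) (hN : 1 ≤ N) (e : ↥(plaquetteEdges p))
    (M M' : ↥(plaquetteEdges p) → Matrix.specialUnitaryGroup (Fin N) ℂ)
    (h : ∀ e', e' ≠ e → M e' = M' e') :
    |plaqFun p (fun e' => (M e' : Matrix (Fin N) (Fin N) ℂ)) -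
        plaqFun p (fun e' => (M' e' : Matrix (Fin N) (Fin N) ℂ))| ≤
      4 * (Real.sqrt N)⁻¹ * suFrobDist (M e) (M' e) := by
  have hk : ∀ k, suFrobDist (M k) (M' k) ≤ suFrobDist (M e) (M' e) := by
    intro k
    by_cases hke : k = e
    · rw [hke]
    · rw [h k hke, suFrobDist_self]
      exact suFrobDist_nonneg _ _
  refine (plaqFun_sub_le p M M' hN).trans ?_
  have hs : 0 ≤ (Real.sqrt N)⁻¹ := inv_nonneg.2 (Real.sqrt_nonneg _)
  nlinarith [hk (pe₁ p), hk (pe₂ p), hk (pe₃ p), hk (pe₄ p), hs]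

/-- Dictionary: on `SU(N)` configurations the cylinder function `plaqFun` is the tree's normalised
plaquette observable `(1/N) Re tr ρ(hol_p)` (`plaquetteObs` of `LatticeGaugeDLR`, group inverses
becoming conjugate transposes). -/
theorem matrixCylinder_plaqFun (p : ZdP d) (U : LGConfig d (Matrix.specialUnitaryGroup (Fin N) ℂ)) :
    matrixCylinder (plaquetteEdges p) (plaqFun p) U =
      (N : ℝ)⁻¹ * plaquetteObs (fundamentalRep (Fin N)) p.1 p.2.1.1 p.2.1.2 U := by
  simp only [matrixCylinder, plaqFun, pe₁, pe₂, pe₃, pe₄, plaquetteObs, plaquetteHolonomyZd,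
    map_mul, fundamentalRep_apply, su_coe_inv]

/-! ## The variance bound at the sharp window -/

/-- **Large-`N` concentration of the plaquette for `|β| < 1/(8d)`** (SZZ Cor. 1.5, plaquette case,
sharp window), conditional on the Bakry–Émery transfer fact: for `d ≥ 2`, `N ≥ 1`, `|β| < 1/(8d)`
and every infinite-volume limit point `μ` of the torus `SU(N)` Wilson states at tree coupling `Nβ`,
`Var_μ((1/N) Re tr hol_p) ≤ (1/K) · 64/N`, `K = N/2 - 4dN|β|`. -/
theorem plaquette_variance_sharp (h : shenZhuZhu_bakryEmery_transfer d N) (hd : 2 ≤ d) (hN : 1 ≤ N)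
    {β : ℝ} (hβ : |β| < sharpThresholdSU d)
    {μ : Measure (LGConfig d (Matrix.specialUnitaryGroup (Fin N) ℂ))}
    (hμ : μ ∈ infiniteVolumeLimitPoints (d := d) (fundamentalRep (Fin N)) ((N : ℝ) * β))
    (p : ZdP d) :
    Var[matrixCylinder (plaquetteEdges p) (plaqFun p); μ] ≤
      1 / sharpBakryEmeryConstSU N d β * (64 / N) := by
  have hFI := sharp_functionalInequalities h hd hN hβ μ hμ (plaquetteEdges p) (plaqFun p)
    (fun _ => 4 * (Real.sqrt N)⁻¹) (contDiff_plaqFun p)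
    (fun _ => by positivity) (fun e M M' hMM' => plaqFun_lipschitz p hN e M M' hMM')
  refine hFI.2.trans (le_of_eq ?_)
  congr 1
  have hN0 : (0 : ℝ) < N := by exact_mod_cast hN
  rw [Finset.sum_const, Finset.card_univ, Fintype.card_coe, nsmul_eq_mul]
  have hcard : ((plaquetteEdges p).card : ℝ) = 4 := by
    have h4 : (plaquetteEdges p).card = 4 := by
      -- the four links of a plaquette are distinct
      obtain ⟨x, ⟨⟨i, j⟩, hij⟩⟩ := p
      have hij' : i ≠ j := ne_of_lt hij
      have hi0 : Pi.single (M := fun _ : Fin d => ℤ) i (1 : ℤ) ≠ 0 := by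
        intro h0; have := congrFun h0 i; simp at this
      have hj0 : Pi.single (M := fun _ : Fin d => ℤ) j (1 : ℤ) ≠ 0 := by
        intro h0; have := congrFun h0 j; simp at this
      have hij0 : Pi.single (M := fun _ : Fin d => ℤ) i (1 : ℤ) ≠ Pi.single j 1 := by
        intro h0; have := congrFun h0 i; simp [hij'] at this
      simp only [plaquetteEdges]
      rw [Finset.card_insert_of_notMem, Finset.card_insert_of_notMem, Finset.card_insert_of_notMem,
        Finset.card_singleton]
      · simp [Prod.ext_iff, hij', hj0]
      · simp [Prod.ext_iff, hij'.symm, hi0, hij0]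
      · simp [Prod.ext_iff, hij', hi0, hj0]
    exact_mod_cast h4
  rw [hcard, mul_pow, inv_pow, Real.sq_sqrt hN0.le]
  field_simp
  ring

/-- The same bound in closed form: `Var_μ(W_p/N) ≤ 128/(N²(1 - 8d|β|))` — it tends to `0` as
`N → ∞` at fixed 't Hooft coupling `|β| < 1/(8d)`. -/
theorem plaquette_variance_sharp' (h : shenZhuZhu_bakryEmery_transfer d N) (hd : 2 ≤ d) (hN : 1 ≤ N)
    {β : ℝ} (hβ : |β| < sharpThresholdSU d)
    {μ : Measure (LGConfig d (Matrix.specialUnitaryGroup (Fin N) ℂ))}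
    (hμ : μ ∈ infiniteVolumeLimitPoints (d := d) (fundamentalRep (Fin N)) ((N : ℝ) * β))
    (p : ZdP d) :
    Var[matrixCylinder (plaquetteEdges p) (plaqFun p); μ] ≤
      128 / ((N : ℝ) ^ 2 * (1 - 8 * d * |β|)) := by
  refine (plaquette_variance_sharp h hd hN hβ hμ p).trans (le_of_eq ?_)
  have hN0 : (0 : ℝ) < N := by exact_mod_cast hN
  have hK : 0 < 1 - 8 * (d : ℝ) * |β| := by
    have hd' : (0 : ℝ) < 8 * d := by
      have : (2 : ℝ) ≤ d := by exact_mod_cast hd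
      linarith
    have := hβ
    unfold sharpThresholdSU at this
    rw [lt_div_iff₀ hd'] at this
    nlinarith
  unfold sharpBakryEmeryConstSU
  have : (N : ℝ) / 2 - 4 * d * N * |β| = N * (1 - 8 * d * |β|) / 2 := by ring
  rw [this]
  field_simp
  ring

end Summit.Ventures.YMGap.HessianSharp
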